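import Summits.AnomalousDissipation.AnomalousDissipation.Theorems.SawtoothPulseCascadeApproxLipTools
import Literature.Analysis.FunctionSpaces.TorusAgmonPlanar
import Literature.Analysis.FluidPDE.TorusLinearisedNSVorticityGradientGrowth
import HarnessLib

/-!
# From `L²` sizes of the vorticity derivatives to the pointwise Lipschitz size on `𝕋²` (Agmon packaging)
(route `AnomalousDissipation/SawtoothPulseCascade`, crux ApproxSol58 = stmt-AnomalousDissipation-19688, line
`lip-agmon` of the lead g4; support module "tail T1/T2", support seat g7)

The line `lip-agmon` controls, phase by phase, the `L²` sizes of the response vorticity `ω = ∂₀L₁ − ∂₁L₀` and of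
its first and second partial derivatives (`…LipAgmonResponseSlot`, `…LipAgmonPhase`).  This file turns such sizes
into the continuous Lipschitz majorant `Λ` demanded by `DriftFreeApprox.approximateSolution_of_envelopes`:

* §1 (fixed time) **Agmon on `∂ⱼL`**: for smooth divergence-free planar `L`,
  `‖∂ⱼL(x)‖² ≤ C_A · ‖ω‖₂ · (‖∂ⱼ∂₀ω‖₂² + ‖∂ⱼ∂₁ω‖₂²)^{1/2}` (tree Agmon `Torus.exists_norm_sq_le_agmon_fin_two`,
  p502600, applied to the zero-mean field `∂ⱼL`, with `‖∂ⱼL‖₂ ≤ ‖ω‖₂` and `‖Δ∂ⱼL‖₂² = ‖∂ⱼ∂₀ω‖₂² + ‖∂ⱼ∂₁ω‖₂²`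
  from the planar kinematics `ΔL = ∇⊥ω`, p504241); size forms `‖∂ⱼL(x)‖ ≤ √(C_A Z S)` and
  `‖DL(x)‖ ≤ 2√(C_A Z S)` whenever `‖ω‖₂ ≤ Z` and `‖∂₀∂₀ω‖₂ + ‖∂₀∂₁ω‖₂ + ‖∂₁∂₁ω‖₂ ≤ S`;
* §2 (time) for `L` jointly smooth on `[a, b] × 𝕋²` with divergence-free slices, the continuous envelope `Λ` of
  `ApproxResponse.exists_lipEnvelope` (p497905) obeys `‖DL(t)(x)‖ ≤ Λ(t) ≤ 2√(C_A Z S)` at every time where the two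
  sizes hold;
* §3 the closure arithmetic of the line at `ρN = 2`: `256r + 16(1+γ)² + 4(1+γ+γ²)² < r³` for `r = γ² − 3`,
  `γ ∈ [5, 8]` (value `10052 < 10648` at `γ = 5`), its ratio form `σμ·R_V < r⁴` (`σ = 4`, `0 ≤ μ ≤ r`,
  `R_W = σ²μ + (1+γ)²`, `R_V = σR_W + (1+γ+γ²)²` as in `LipAgmon.phase_bounds`), the square-root form, and the
  monomial algebra `√(C·(Xν(j+1)Aʲ⁺¹)·(Yν(j+1)Bʲ⁺¹)) = √(CXY)·ν(j+1)·(√(AB))ʲ⁺¹`.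
-/

set_option linter.dupNamespace false

noncomputable section

namespace Summit.AnomalousDissipation.AnomalousDissipation.Theorems.SawtoothPulseCascade.LipAgmon

open Set MeasureTheory
open scoped ContDiff
open Literature.Analysis Literature.Analysis.FunctionSpaces Literature.Analysis.FluidPDE
open Summit.AnomalousDissipation.AnomalousDissipation.Theorems.SawtoothPulseCascade.ApproxResponse

/-! ## §1 Agmon on `∂ⱼL` at a fixed time -/

section Fixed

/-- **Agmon on `∂ⱼL` (planar, divergence free).** There is `C_A > 0` such that for every smooth divergence-free
`L : 𝕋² → ℝ²`, with `ω = W(L)₀₁ = ∂₀L₁ − ∂₁L₀`, every direction `j` and every point `x`: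
`‖∂ⱼL(x)‖² ≤ C_A · (∫ω²)^{1/2} · (∫(∂ⱼ∂₀ω)² + ∫(∂ⱼ∂₁ω)²)^{1/2}`.
[cite: RobinsonSadowskiSilva2012, Lemma 3.2 (Agmon on the torus); MajdaBertozzi2002, §2.1 (2.5)–(2.6) (ΔL = ∇⊥ω)] -/
theorem exists_agmon_partialDeriv_sq_le :
    ∃ C : ℝ, 0 < C ∧ ∀ L : UnitAddTorus (Fin 2) → EuclideanSpace ℝ (Fin 2), Torus.IsSmooth L → Torus.IsDivFree L →
      ∀ (j : Fin 2) (x : UnitAddTorus (Fin 2)),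
        ‖Torus.partialDeriv j L x‖ ^ 2 ≤
          C * Real.sqrt (∫ y, torusVorticityTensor L 0 1 y ^ 2) *
            Real.sqrt ((∫ y, (Torus.partialDeriv j (Torus.partialDeriv 0 (torusVorticityTensor L 0 1)) y) ^ 2) +
              ∫ y, (Torus.partialDeriv j (Torus.partialDeriv 1 (torusVorticityTensor L 0 1)) y) ^ 2) := by
  obtain ⟨C, hC0, hC⟩ := Torus.exists_norm_sq_le_agmon_fin_two
  refine ⟨C, hC0, fun L hL hdiv j x => ?_⟩
  have h := hC (Torus.partialDeriv j L) (hL.partialDeriv j) (Torus.hasZeroMean_partialDeriv_fin_two hL j) x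
  rw [Torus.integral_norm_laplacian_partialDeriv_sq_eq_fin_two hL hdiv j] at h
  refine h.trans ?_
  have h1 : Real.sqrt (∫ y, ‖Torus.partialDeriv j L y‖ ^ 2) ≤ Real.sqrt (∫ y, torusVorticityTensor L 0 1 y ^ 2) :=
    Real.sqrt_le_sqrt (Torus.integral_norm_partialDeriv_sq_le_integral_vorticity_sq_fin_two hL hdiv j)
  exact mul_le_mul_of_nonneg_right (mul_le_mul_of_nonneg_left h1 hC0.le) (Real.sqrt_nonneg _)

/-- **Size form of Agmon on `∂ⱼL`, with the operator norm.** With the constant `C_A` of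
`exists_agmon_partialDeriv_sq_le`: if `‖ω‖₂ ≤ Z` and `‖∂₀∂₀ω‖₂ + ‖∂₀∂₁ω‖₂ + ‖∂₁∂₁ω‖₂ ≤ S` (here
`‖∂ₐ∂_bω‖₂ = (∫(∂ₐ(∂_bω))²)^{1/2}`), then `‖∂ⱼL(x)‖ ≤ √(C_A Z S)` for both `j`, `Σⱼ ‖∂ⱼL(x)‖ ≤ 2√(C_A Z S)` and
`‖DL(x)‖ ≤ 2√(C_A Z S)` (operator norm `Torus.fderiv`). [cite: RobinsonSadowskiSilva2012, Lemma 3.2] -/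
theorem exists_agmon_sizes :
    ∃ C : ℝ, 0 < C ∧ ∀ L : UnitAddTorus (Fin 2) → EuclideanSpace ℝ (Fin 2), Torus.IsSmooth L → Torus.IsDivFree L →
      ∀ Z S : ℝ,
        Real.sqrt (∫ y, torusVorticityTensor L 0 1 y ^ 2) ≤ Z →
        Real.sqrt (∫ y, (Torus.partialDeriv 0 (Torus.partialDeriv 0 (torusVorticityTensor L 0 1)) y) ^ 2) +
            Real.sqrt (∫ y, (Torus.partialDeriv 0 (Torus.partialDeriv 1 (torusVorticityTensor L 0 1)) y) ^ 2) +
            Real.sqrt (∫ y, (Torus.partialDeriv 1 (Torus.partialDeriv 1 (torusVorticityTensor L 0 1)) y) ^ 2) ≤ S →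
        (∀ (j : Fin 2) (x : UnitAddTorus (Fin 2)), ‖Torus.partialDeriv j L x‖ ≤ Real.sqrt (C * Z * S)) ∧
        (∀ x : UnitAddTorus (Fin 2), ∑ j, ‖Torus.partialDeriv j L x‖ ≤ 2 * Real.sqrt (C * Z * S)) ∧
        (∀ x : UnitAddTorus (Fin 2), ‖Torus.fderiv L x‖ ≤ 2 * Real.sqrt (C * Z * S)) := by
  obtain ⟨C, hC0, hC⟩ := exists_agmon_partialDeriv_sq_le
  refine ⟨C, hC0, fun L hL hdiv Z S hZ hS => ?_⟩
  set W : UnitAddTorus (Fin 2) → ℝ := torusVorticityTensor L 0 1 with hW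
  have hWs : Torus.IsSmooth W := ((hL.partialDeriv 0).apply 1).sub ((hL.partialDeriv 1).apply 0)
  -- abbreviations for the `L²` norms of the second derivatives
  set V : Fin 2 → Fin 2 → ℝ := fun a b =>
    Real.sqrt (∫ y, (Torus.partialDeriv a (Torus.partialDeriv b W) y) ^ 2) with hV
  have hV0 : ∀ a b, 0 ≤ V a b := fun a b => Real.sqrt_nonneg _
  have hV10 : V 1 0 = V 0 1 := by
    simp only [hV]
    congr 1
    refine integral_congr_ae (Filter.Eventually.of_forall fun y => ?_)
    simp only [Torus.partialDeriv_comm hWs 1 0 y]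
  have hZ0 : 0 ≤ Z := (Real.sqrt_nonneg _).trans hZ
  have hS' : V 0 0 + V 0 1 + V 1 1 ≤ S := hS
  have hS0 : 0 ≤ S := le_trans (by positivity) hS'
  -- `√(a + b) ≤ √a + √b` (cf. `MRT2015.sqrt_add_le_sqrt_add_sqrt`, not imported here)
  have hsqrt : ∀ {a b : ℝ}, 0 ≤ a → 0 ≤ b → Real.sqrt (a + b) ≤ Real.sqrt a + Real.sqrt b := by
    intro a b ha hb
    refine Real.sqrt_le_iff.2 ⟨add_nonneg (Real.sqrt_nonneg _) (Real.sqrt_nonneg _), ?_⟩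
    have ha' := Real.sq_sqrt ha
    have hb' := Real.sq_sqrt hb
    nlinarith [mul_nonneg (Real.sqrt_nonneg a) (Real.sqrt_nonneg b)]
  -- the `j`-wise second-derivative size is at most `S`
  have hj : ∀ j : Fin 2,
      Real.sqrt ((∫ y, (Torus.partialDeriv j (Torus.partialDeriv 0 W) y) ^ 2) +
        ∫ y, (Torus.partialDeriv j (Torus.partialDeriv 1 W) y) ^ 2) ≤ S := by
    intro j
    refine (hsqrt (integral_nonneg fun y => sq_nonneg _) (integral_nonneg fun y => sq_nonneg _)).trans ?_
    change V j 0 + V j 1 ≤ S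
    fin_cases j
    · simpa using (show V 0 0 + V 0 1 ≤ S by linarith [hV0 1 1])
    · simpa [hV10] using (show V 0 1 + V 1 1 ≤ S by linarith [hV0 0 0])
  have hmain : ∀ (j : Fin 2) (x : UnitAddTorus (Fin 2)), ‖Torus.partialDeriv j L x‖ ≤ Real.sqrt (C * Z * S) := by
    intro j x
    have h := hC L hL hdiv j x
    have h2 : ‖Torus.partialDeriv j L x‖ ^ 2 ≤ C * Z * S := by
      refine h.trans ?_
      have a1 : C * Real.sqrt (∫ y, W y ^ 2) ≤ C * Z := mul_le_mul_of_nonneg_left hZ hC0.le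
      calc C * Real.sqrt (∫ y, W y ^ 2) *
            Real.sqrt ((∫ y, (Torus.partialDeriv j (Torus.partialDeriv 0 W) y) ^ 2) +
              ∫ y, (Torus.partialDeriv j (Torus.partialDeriv 1 W) y) ^ 2)
          ≤ C * Z * Real.sqrt ((∫ y, (Torus.partialDeriv j (Torus.partialDeriv 0 W) y) ^ 2) +
              ∫ y, (Torus.partialDeriv j (Torus.partialDeriv 1 W) y) ^ 2) :=
            mul_le_mul_of_nonneg_right a1 (Real.sqrt_nonneg _)
        _ ≤ C * Z * S := mul_le_mul_of_nonneg_left (hj j) (by positivity)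
    calc ‖Torus.partialDeriv j L x‖ = Real.sqrt (‖Torus.partialDeriv j L x‖ ^ 2) := by
          rw [Real.sqrt_sq (norm_nonneg _)]
      _ ≤ Real.sqrt (C * Z * S) := Real.sqrt_le_sqrt h2
  have hsum : ∀ x : UnitAddTorus (Fin 2), ∑ j, ‖Torus.partialDeriv j L x‖ ≤ 2 * Real.sqrt (C * Z * S) := by
    intro x
    rw [Fin.sum_univ_two]
    linarith [hmain 0 x, hmain 1 x]
  refine ⟨hmain, hsum, fun x => ?_⟩
  exact (norm_fderiv_le_sum_norm_partialDeriv (hL.isContDiff (by simp)) x).trans (hsum x)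

end Fixed

/-! ## §2 The continuous Lipschitz envelope of a time-dependent planar field -/

section Time

/-- **Time form.** With the constant `C_A` of §1: for `L` jointly smooth on `[a, b] × 𝕋²` (`a < b`) with
divergence-free slices there is a continuous `Λ` on `[a, b]` with `‖DL(t)(x)‖ ≤ Λ(t)` everywhere, and
`Λ(t) ≤ 2√(C_A Z S)` at every time `t ∈ [a, b]` at which `‖ω(t)‖₂ ≤ Z` and
`‖∂₀∂₀ω(t)‖₂ + ‖∂₀∂₁ω(t)‖₂ + ‖∂₁∂₁ω(t)‖₂ ≤ S` (`Λ` = the envelope `Σᵢ‖∂ᵢL(t)‖_∞` of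
`ApproxResponse.exists_lipEnvelope`). [cite: RobinsonSadowskiSilva2012, Lemma 3.2] -/
theorem exists_agmon_lipEnvelope :
    ∃ C : ℝ, 0 < C ∧ ∀ (a b : ℝ), a < b → ∀ L : ℝ → UnitAddTorus (Fin 2) → EuclideanSpace ℝ (Fin 2),
      Torus.IsSmoothSpaceTimeOn (Icc a b) L → (∀ t ∈ Icc a b, Torus.IsDivFree (L t)) →
      ∃ Λ : ℝ → ℝ, ContinuousOn Λ (Icc a b) ∧
        (∀ t ∈ Icc a b, ∀ x, ‖Torus.fderiv (L t) x‖ ≤ Λ t) ∧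
        (∀ t ∈ Icc a b, 0 ≤ Λ t) ∧
        ∀ t ∈ Icc a b, ∀ Z S : ℝ,
          Real.sqrt (∫ y, torusVorticityTensor (L t) 0 1 y ^ 2) ≤ Z →
          Real.sqrt (∫ y, (Torus.partialDeriv 0 (Torus.partialDeriv 0 (torusVorticityTensor (L t) 0 1)) y) ^ 2) +
              Real.sqrt (∫ y, (Torus.partialDeriv 0 (Torus.partialDeriv 1 (torusVorticityTensor (L t) 0 1)) y) ^ 2) +
              Real.sqrt (∫ y, (Torus.partialDeriv 1 (Torus.partialDeriv 1 (torusVorticityTensor (L t) 0 1)) y) ^ 2) ≤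
            S →
          Λ t ≤ 2 * Real.sqrt (C * Z * S) := by
  obtain ⟨C, hC0, hC⟩ := exists_agmon_sizes
  refine ⟨C, hC0, fun a b hab L hL hdiv => ?_⟩
  obtain ⟨Λ, hΛc, hΛD, hΛsum, hΛM⟩ := exists_lipEnvelope (d := Fin 2) hab hL
  refine ⟨Λ, hΛc, hΛD, fun t ht => ?_, fun t ht Z S hZ hS => ?_⟩
  · exact le_trans (Finset.sum_nonneg fun i _ => norm_nonneg _) (hΛsum t ht (0 : UnitAddTorus (Fin 2)))
  · obtain ⟨hj, -, -⟩ := hC (L t) (hL.isSmooth_slice ht) (hdiv t ht) Z S hZ hS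
    have h := hΛM t ht (Real.sqrt (C * Z * S)) (Real.sqrt_nonneg _) fun i x => hj i x
    have hcard : (Fintype.card (Fin 2) : ℝ) = 2 := by simp
    rw [hcard] at h
    exact h

end Time

/-! ## §3 Closure arithmetic of the line at `ρN = 2` -/

section Arith

/-- **The closure inequality at `ρN = 2`:** `256(γ²−3) + 16(1+γ)² + 4(1+γ+γ²)² < (γ²−3)³` on `[5, 8]`
(at `γ = 5`: `5632 + 576 + 3844 = 10052 < 10648`; the difference is increasing in `γ`). [folklore] -/
theorem closure_poly_lt {γ : ℝ} (hγ : γ ∈ Icc (5 : ℝ) 8) :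
    256 * (γ ^ 2 - 3) + 16 * (1 + γ) ^ 2 + 4 * (1 + γ + γ ^ 2) ^ 2 < (γ ^ 2 - 3) ^ 3 := by
  obtain ⟨h5, h8⟩ := hγ
  have ht : 0 ≤ γ - 5 := by linarith
  -- substitute `γ = 5 + t`, `t ≥ 0`: every coefficient of the difference is positive
  nlinarith [ht, pow_nonneg ht 2, pow_nonneg ht 3, pow_nonneg ht 4, pow_nonneg ht 5, pow_nonneg ht 6,
    mul_nonneg ht (pow_nonneg ht 2)]

/-- Ratio form: with `σ = 4`, `R_W = σ²μ + (1+γ)²`, `R_V = σR_W + (1+γ+γ²)²` (the ratios of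
`LipAgmon.phase_bounds` at `ρN = 2`) and `0 ≤ μ ≤ γ² − 3`: `σμ · R_V < (γ²−3)⁴`. [folklore] -/
theorem closure_ratio_lt {γ μ : ℝ} (hγ : γ ∈ Icc (5 : ℝ) 8) (hμ0 : 0 ≤ μ) (hμ : μ ≤ γ ^ 2 - 3) :
    4 * μ * (4 * (4 ^ 2 * μ + (1 + γ) ^ 2) + (1 + γ + γ ^ 2) ^ 2) < (γ ^ 2 - 3) ^ 4 := by
  have hr : 0 < γ ^ 2 - 3 := by have := hγ.1; nlinarith
  have hp := closure_poly_lt hγ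
  have hγ0 : 0 ≤ γ := le_trans (by norm_num) hγ.1
  -- monotone in `μ`
  have h1 : 4 * μ * (4 * (4 ^ 2 * μ + (1 + γ) ^ 2) + (1 + γ + γ ^ 2) ^ 2) ≤
      4 * (γ ^ 2 - 3) * (4 * (4 ^ 2 * (γ ^ 2 - 3) + (1 + γ) ^ 2) + (1 + γ + γ ^ 2) ^ 2) := by
    have a : 4 * (4 ^ 2 * μ + (1 + γ) ^ 2) + (1 + γ + γ ^ 2) ^ 2 ≤
        4 * (4 ^ 2 * (γ ^ 2 - 3) + (1 + γ) ^ 2) + (1 + γ + γ ^ 2) ^ 2 := by nlinarith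
    have b : 0 ≤ 4 * (4 ^ 2 * μ + (1 + γ) ^ 2) + (1 + γ + γ ^ 2) ^ 2 := by positivity
    calc 4 * μ * (4 * (4 ^ 2 * μ + (1 + γ) ^ 2) + (1 + γ + γ ^ 2) ^ 2)
        ≤ 4 * (γ ^ 2 - 3) * (4 * (4 ^ 2 * μ + (1 + γ) ^ 2) + (1 + γ + γ ^ 2) ^ 2) := by
          have : 4 * μ ≤ 4 * (γ ^ 2 - 3) := by linarith
          exact mul_le_mul_of_nonneg_right this b
      _ ≤ 4 * (γ ^ 2 - 3) * (4 * (4 ^ 2 * (γ ^ 2 - 3) + (1 + γ) ^ 2) + (1 + γ + γ ^ 2) ^ 2) :=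
          mul_le_mul_of_nonneg_left a (by positivity)
  have h2 : 4 * (γ ^ 2 - 3) * (4 * (4 ^ 2 * (γ ^ 2 - 3) + (1 + γ) ^ 2) + (1 + γ + γ ^ 2) ^ 2) =
      (γ ^ 2 - 3) * (256 * (γ ^ 2 - 3) + 16 * (1 + γ) ^ 2 + 4 * (1 + γ + γ ^ 2) ^ 2) := by ring
  have h3 : (γ ^ 2 - 3) * (256 * (γ ^ 2 - 3) + 16 * (1 + γ) ^ 2 + 4 * (1 + γ + γ ^ 2) ^ 2) <
      (γ ^ 2 - 3) * (γ ^ 2 - 3) ^ 3 := mul_lt_mul_of_pos_left hp hr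
  calc 4 * μ * (4 * (4 ^ 2 * μ + (1 + γ) ^ 2) + (1 + γ + γ ^ 2) ^ 2)
      ≤ (γ ^ 2 - 3) * (256 * (γ ^ 2 - 3) + 16 * (1 + γ) ^ 2 + 4 * (1 + γ + γ ^ 2) ^ 2) := h1.trans_eq h2
    _ < (γ ^ 2 - 3) * (γ ^ 2 - 3) ^ 3 := h3
    _ = (γ ^ 2 - 3) ^ 4 := by ring

/-- Square-root form: `M₁ := √(σμ·R_V) < (γ²−3)²` (`σ = 4`, `0 ≤ μ ≤ γ²−3`). [folklore] -/
theorem closure_sqrt_lt {γ μ : ℝ} (hγ : γ ∈ Icc (5 : ℝ) 8) (hμ0 : 0 ≤ μ) (hμ : μ ≤ γ ^ 2 - 3) :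
    Real.sqrt (4 * μ * (4 * (4 ^ 2 * μ + (1 + γ) ^ 2) + (1 + γ + γ ^ 2) ^ 2)) < (γ ^ 2 - 3) ^ 2 := by
  have hr : 0 < γ ^ 2 - 3 := by have := hγ.1; nlinarith
  rw [show (γ ^ 2 - 3) ^ 2 = Real.sqrt (((γ ^ 2 - 3) ^ 2) ^ 2) by rw [Real.sqrt_sq (by positivity)]]
  refine Real.sqrt_lt_sqrt (by positivity) ?_
  calc 4 * μ * (4 * (4 ^ 2 * μ + (1 + γ) ^ 2) + (1 + γ + γ ^ 2) ^ 2) < (γ ^ 2 - 3) ^ 4 :=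
        closure_ratio_lt hγ hμ0 hμ
    _ = ((γ ^ 2 - 3) ^ 2) ^ 2 := by ring

/-- The generic ratio form for any scale ratio: if `σμ(σ(σ²μ + T₁) + T₂) < r⁴` then
`√(σμ(σ(σ²μ + T₁) + T₂)) < r²` (`r > 0`). [folklore] -/
theorem sqrt_lt_sq_of_lt_pow_four {x r : ℝ} (hr : 0 < r) (hx : x < r ^ 4) : Real.sqrt x < r ^ 2 := by
  rw [show r ^ 2 = Real.sqrt ((r ^ 2) ^ 2) by rw [Real.sqrt_sq (by positivity)]]
  rcases le_or_gt 0 x with hx0 | hx0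
  · exact Real.sqrt_lt_sqrt hx0 (by calc x < r ^ 4 := hx
      _ = (r ^ 2) ^ 2 := by ring)
  · rw [Real.sqrt_eq_zero'.2 hx0.le]
    exact Real.sqrt_pos.2 (by positivity)

/-- **Monomial algebra for the Agmon product of two geometric envelopes:** for `C, X, Y, A, B, ν ≥ 0`,
`√(C · (Xν(j+1)Aʲ⁺¹) · (Yν(j+1)Bʲ⁺¹)) = √(CXY) · ν · (j+1) · (√(AB))ʲ⁺¹`. [folklore] -/
theorem sqrt_envelope_product {C X Y A B ν : ℝ} (hC : 0 ≤ C) (hX : 0 ≤ X) (hY : 0 ≤ Y) (hA : 0 ≤ A)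
    (hB : 0 ≤ B) (hν : 0 ≤ ν) (j : ℕ) :
    Real.sqrt (C * (X * ν * ((j : ℝ) + 1) * A ^ (j + 1)) * (Y * ν * ((j : ℝ) + 1) * B ^ (j + 1))) =
      Real.sqrt (C * X * Y) * ν * ((j : ℝ) + 1) * Real.sqrt (A * B) ^ (j + 1) := by
  have h1 : 0 ≤ C * X * Y := by positivity
  have h2 : 0 ≤ A * B := by positivity
  have hr : 0 ≤ Real.sqrt (C * X * Y) * ν * ((j : ℝ) + 1) * Real.sqrt (A * B) ^ (j + 1) := by positivity
  have e : C * (X * ν * ((j : ℝ) + 1) * A ^ (j + 1)) * (Y * ν * ((j : ℝ) + 1) * B ^ (j + 1)) =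
      (Real.sqrt (C * X * Y) * ν * ((j : ℝ) + 1) * Real.sqrt (A * B) ^ (j + 1)) ^ 2 := by
    rw [show (Real.sqrt (C * X * Y) * ν * ((j : ℝ) + 1) * Real.sqrt (A * B) ^ (j + 1)) ^ 2 =
        Real.sqrt (C * X * Y) ^ 2 * (ν * ((j : ℝ) + 1)) ^ 2 * (Real.sqrt (A * B) ^ 2) ^ (j + 1) by ring,
      Real.sq_sqrt h1, Real.sq_sqrt h2]
    ring
  rw [e, Real.sqrt_sq hr]

/-- Upper-bound form: if `0 ≤ z ≤ Xν(j+1)Aʲ⁺¹` and `0 ≤ s ≤ Yν(j+1)Bʲ⁺¹` then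
`2√(C z s) ≤ 2√(CXY) · ν(j+1) · (√(AB))ʲ⁺¹` (`C, X, Y, A, B, ν ≥ 0`). [folklore] -/
theorem two_sqrt_le_envelope {C X Y A B ν z s : ℝ} (hC : 0 ≤ C) (hX : 0 ≤ X) (hY : 0 ≤ Y) (hA : 0 ≤ A)
    (hB : 0 ≤ B) (hν : 0 ≤ ν) (j : ℕ) (hz0 : 0 ≤ z) (hz : z ≤ X * ν * ((j : ℝ) + 1) * A ^ (j + 1))
    (hs0 : 0 ≤ s) (hs : s ≤ Y * ν * ((j : ℝ) + 1) * B ^ (j + 1)) :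
    2 * Real.sqrt (C * z * s) ≤
      2 * (Real.sqrt (C * X * Y) * ν * ((j : ℝ) + 1) * Real.sqrt (A * B) ^ (j + 1)) := by
  rw [← sqrt_envelope_product hC hX hY hA hB hν j]
  refine mul_le_mul_of_nonneg_left (Real.sqrt_le_sqrt ?_) (by norm_num)
  exact mul_le_mul (mul_le_mul_of_nonneg_left hz hC) hs hs0 (mul_nonneg hC (hz0.trans hz))

end Arith

/-! ## §4 The `Λ`-clause of `DriftFreeApprox.envelopeBookkeeping` from geometric phase sizes (amendment 1) -/

section Clause

open Literature.Analysis.FluidPDE.SawtoothCascade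

/-- `Xν(j+2)aʲ⁺¹ ≤ (2X)ν(j+1)aʲ⁺¹`: a size bound carrying the NEXT phase's counting factor (the end-of-phase
outputs of `LipAgmon.phase_bounds`) is absorbed by doubling the constant. [folklore] -/
theorem size_succ_le {X a ν : ℝ} (hX : 0 ≤ X) (ha : 0 ≤ a) (hν : 0 ≤ ν) (j : ℕ) :
    X * ν * ((j : ℝ) + 2) * a ^ (j + 1) ≤ 2 * X * ν * ((j : ℝ) + 1) * a ^ (j + 1) := by
  have hj : (0 : ℝ) ≤ j := Nat.cast_nonneg j
  have h1 : (j : ℝ) + 2 ≤ 2 * ((j : ℝ) + 1) := by linarith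
  have h2 : 0 ≤ X * ν := mul_nonneg hX hν
  nlinarith [mul_nonneg h2 (pow_nonneg ha (j + 1)), mul_le_mul_of_nonneg_left h1 (mul_nonneg h2 (pow_nonneg ha (j + 1)))]

/-- **The `Λ`-clause from geometric phase sizes.** With the Agmon constant `C_A` of §1: let `L` be jointly smooth
on `[0, T'] × 𝕋²` (`T' > 0`) with divergence-free slices, `0 ≤ T ≤ T'`, and suppose that at every time `t ≤ T`
of phase `j` (i.e. `t ∈ [tStart j, tStart (j+1)]`) the response vorticity `ω(t) = W(L(t))₀₁` has
`‖ω(t)‖₂ ≤ Xν(j+1)aʲ⁺¹` and `‖∂₀∂₀ω(t)‖₂ + ‖∂₀∂₁ω(t)‖₂ + ‖∂₁∂₁ω(t)‖₂ ≤ Yν(j+1)bʲ⁺¹` (`X, Y, a, b, ν ≥ 0`).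
Then there is `Λ`, continuous on `[0, T]`, with `‖DL(t)(x)‖ ≤ Λ(t)` and, for `t ≤ T` in phase `j`,
`0 ≤ Λ(t) ≤ K₁ν(j+1)M₁ʲ⁺¹` where `K₁ = 2√(C_A X Y)` and `M₁ = √(ab)` — literally the `Λ`-hypothesis of
`DriftFreeApprox.envelopeBookkeeping` (p478671) once `M₁ < (γ²−3)²` (`closure_sqrt_lt` at `ρN = 2`).
[cite: RobinsonSadowskiSilva2012, Lemma 3.2 (Agmon on the torus)] -/
theorem exists_lipEnvelope_clause_of_sizes :
    ∃ C : ℝ, 0 < C ∧ ∀ (T' : ℝ), 0 < T' → ∀ L : ℝ → UnitAddTorus (Fin 2) → EuclideanSpace ℝ (Fin 2),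
      Torus.IsSmoothSpaceTimeOn (Icc 0 T') L → (∀ t ∈ Icc 0 T', Torus.IsDivFree (L t)) →
      ∀ (T X Y a b ν : ℝ), 0 ≤ T → T ≤ T' → 0 ≤ X → 0 ≤ Y → 0 ≤ a → 0 ≤ b → 0 ≤ ν →
      (∀ j : ℕ, ∀ t ∈ Icc 0 T, t ∈ Icc (CascadeParams.tStart j) (CascadeParams.tStart (j + 1)) →
        Real.sqrt (∫ y, torusVorticityTensor (L t) 0 1 y ^ 2) ≤ X * ν * ((j : ℝ) + 1) * a ^ (j + 1) ∧
        Real.sqrt (∫ y, (Torus.partialDeriv 0 (Torus.partialDeriv 0 (torusVorticityTensor (L t) 0 1)) y) ^ 2) +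
            Real.sqrt (∫ y, (Torus.partialDeriv 0 (Torus.partialDeriv 1 (torusVorticityTensor (L t) 0 1)) y) ^ 2) +
            Real.sqrt (∫ y, (Torus.partialDeriv 1 (Torus.partialDeriv 1 (torusVorticityTensor (L t) 0 1)) y) ^ 2) ≤
          Y * ν * ((j : ℝ) + 1) * b ^ (j + 1)) →
      ∃ Λ : ℝ → ℝ, ContinuousOn Λ (Icc 0 T) ∧
        (∀ t ∈ Icc 0 T, ∀ x, ‖Torus.fderiv (L t) x‖ ≤ Λ t) ∧
        ∀ j : ℕ, ∀ t ∈ Icc 0 T, t ∈ Icc (CascadeParams.tStart j) (CascadeParams.tStart (j + 1)) →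
          0 ≤ Λ t ∧ Λ t ≤ 2 * Real.sqrt (C * X * Y) * ν * ((j : ℝ) + 1) * Real.sqrt (a * b) ^ (j + 1) := by
  obtain ⟨C, hC0, hC⟩ := exists_agmon_lipEnvelope
  refine ⟨C, hC0, fun T' hT' L hL hdiv T X Y a b ν hT0 hTT' hX hY ha hb hν hsz => ?_⟩
  obtain ⟨Λ, hΛc, hΛD, hΛ0, hΛle⟩ := hC 0 T' hT' L hL hdiv
  have hsub : Icc 0 T ⊆ Icc 0 T' := Icc_subset_Icc le_rfl hTT'
  refine ⟨Λ, hΛc.mono hsub, fun t ht x => hΛD t (hsub ht) x, fun j t ht htj => ⟨hΛ0 t (hsub ht), ?_⟩⟩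
  obtain ⟨hz, hs⟩ := hsz j t ht htj
  have h1 := hΛle t (hsub ht) _ _ le_rfl le_rfl
  have hz0 : 0 ≤ Real.sqrt (∫ y, torusVorticityTensor (L t) 0 1 y ^ 2) := Real.sqrt_nonneg _
  have hs0 : 0 ≤ Real.sqrt (∫ y, (Torus.partialDeriv 0 (Torus.partialDeriv 0 (torusVorticityTensor (L t) 0 1)) y) ^ 2) +
      Real.sqrt (∫ y, (Torus.partialDeriv 0 (Torus.partialDeriv 1 (torusVorticityTensor (L t) 0 1)) y) ^ 2) +
      Real.sqrt (∫ y, (Torus.partialDeriv 1 (Torus.partialDeriv 1 (torusVorticityTensor (L t) 0 1)) y) ^ 2) := by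
    positivity
  have h2 := two_sqrt_le_envelope (C := C) hC0.le hX hY ha hb hν j hz0 hz hs0 hs
  calc Λ t ≤ 2 * Real.sqrt (C * Real.sqrt (∫ y, torusVorticityTensor (L t) 0 1 y ^ 2) *
        (Real.sqrt (∫ y, (Torus.partialDeriv 0 (Torus.partialDeriv 0 (torusVorticityTensor (L t) 0 1)) y) ^ 2) +
          Real.sqrt (∫ y, (Torus.partialDeriv 0 (Torus.partialDeriv 1 (torusVorticityTensor (L t) 0 1)) y) ^ 2) +
          Real.sqrt (∫ y, (Torus.partialDeriv 1 (Torus.partialDeriv 1 (torusVorticityTensor (L t) 0 1)) y) ^ 2))) := h1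
    _ ≤ 2 * (Real.sqrt (C * X * Y) * ν * ((j : ℝ) + 1) * Real.sqrt (a * b) ^ (j + 1)) := h2
    _ = 2 * Real.sqrt (C * X * Y) * ν * ((j : ℝ) + 1) * Real.sqrt (a * b) ^ (j + 1) := by ring

end Clause

end Summit.AnomalousDissipation.AnomalousDissipation.Theorems.SawtoothPulseCascade.LipAgmon

end
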